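import Mathlib
import Summits.Ventures.HodgeRepro2.T5HeckePermutationModule

/-!
# Transport of `H(G, K)` along an isomorphism `G ≃* G'` with `φ(K) = K'`

Blind cell `pub-hodge-repro2`, seat p8 (gen 13), Tier-5 kernel support.  `T5HeckePermutationModule`
(T5-52) defines `H(G, K)` as the centraliser of the `G`-action in `End_k(k[G/K])`;
`T5HeckeAutomorphismTransport` (T5-83) transports it along an automorphism `σ : G ≃* G` with
`σ(K) = K`.  The record's `K_v` is the stabiliser of a self-dual lattice in `U(H)`, while the
inert-place package speaks about `U(antidiag(1, u, 1))` and its `K_U`: the two are conjugate by an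
element of `GL₃(𝒪_{E_v})` (`T5HermitianIsotropicLattice.map_conj_hyperspecialSubgroup`), an
isomorphism between DIFFERENT groups.  This file is the transport along any `φ : G ≃* G'` with
`g ∈ K ↔ φ g ∈ K'`, by conjugating endomorphisms:

* `quotientEquivOfMulEquiv` — `G/K ≃ G'/K'`, `gK ↦ φ(g)K'`, equivariant (`quotientEquivOfMulEquiv_smul`);
* `permEquivOfMulEquiv` — the induced `k[G/K] ≃ₗ[k] k[G'/K']`, intertwining the permutation
  representations (`conjAlgEquiv_ofMulAction`: `e ∘ ρ(g) ∘ e⁻¹ = ρ'(φ g)`);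
* `mem_centralizer_conjAlgEquiv` / `centralizer_map_conjAlgEquiv` — conjugation by an
  intertwining linear equivalence maps the centraliser of one representation onto the other;
* `heckeAlgebraEquivOfMulEquiv` — **`H(G, K) ≃ₐ[k] H(G', K')`**;
* `heckeAlgebra_mul_comm_of_mulEquiv` — **commutativity is transported**.

README §8(d): uses an L-value-free non-vanishing device: NO.
-/

namespace Summit.Ventures.HodgeRepro2.T5HeckeIsomorphismTransport

open T5HeckePermutationModule

section Generic

variable {k : Type*} [Field k] {G G' : Type*} [Group G] [Group G'] {X X' : Type*} [MulAction G X]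
  [MulAction G' X'] (φ : G ≃* G') (e : MonoidAlgebra k X ≃ₗ[k] MonoidAlgebra k X')

/-- The inverse of an intertwining linear equivalence intertwines along `φ.symm`. -/
theorem conjAlgEquiv_symm_ofMulAction
    (hinter : ∀ g, e.conjAlgEquiv k (Representation.ofMulAction k G X g) =
      Representation.ofMulAction k G' X' (φ g)) (g' : G') :
    e.symm.conjAlgEquiv k (Representation.ofMulAction k G' X' g') =
      Representation.ofMulAction k G X (φ.symm g') := by
  apply LinearMap.ext
  intro x
  apply e.injective
  have h := congrArg (fun f => f (e x)) (hinter (φ.symm g'))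
  simp only [LinearEquiv.conjAlgEquiv_apply, LinearMap.comp_apply, LinearEquiv.coe_coe,
    LinearEquiv.symm_apply_apply, MulEquiv.apply_symm_apply] at h
  rw [LinearEquiv.conjAlgEquiv_apply, LinearMap.comp_apply, LinearMap.comp_apply,
    LinearEquiv.coe_coe, LinearEquiv.coe_coe, LinearEquiv.symm_symm, LinearEquiv.apply_symm_apply, h]

/-- **Conjugation by an intertwining linear equivalence maps the centraliser of `ρ` into the
centraliser of `ρ'`.** -/
theorem mem_centralizer_conjAlgEquiv
    (hinter : ∀ g, e.conjAlgEquiv k (Representation.ofMulAction k G X g) =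
      Representation.ofMulAction k G' X' (φ g))
    {T : Module.End k (MonoidAlgebra k X)}
    (hT : T ∈ Subalgebra.centralizer k (Set.range ⇑(Representation.ofMulAction k G X))) :
    e.conjAlgEquiv k T ∈
      Subalgebra.centralizer k (Set.range ⇑(Representation.ofMulAction k G' X')) := by
  rw [Subalgebra.mem_centralizer_iff]
  rintro _ ⟨g', rfl⟩
  obtain ⟨g, rfl⟩ := φ.surjective g'
  rw [← hinter, ← map_mul, ← map_mul, (Subalgebra.mem_centralizer_iff k).mp hT _ ⟨g, rfl⟩]

/-- The conjugation maps the centraliser of `ρ` ONTO the centraliser of `ρ'`. -/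
theorem centralizer_map_conjAlgEquiv
    (hinter : ∀ g, e.conjAlgEquiv k (Representation.ofMulAction k G X g) =
      Representation.ofMulAction k G' X' (φ g)) :
    (Subalgebra.centralizer k (Set.range ⇑(Representation.ofMulAction k G X))).map
        (e.conjAlgEquiv k : Module.End k (MonoidAlgebra k X) →ₐ[k] Module.End k (MonoidAlgebra k X')) =
      Subalgebra.centralizer k (Set.range ⇑(Representation.ofMulAction k G' X')) := by
  apply le_antisymm
  · rintro _ ⟨T, hT, rfl⟩
    exact mem_centralizer_conjAlgEquiv φ e hinter hT
  · intro T' hT'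
    refine ⟨e.symm.conjAlgEquiv k T',
      mem_centralizer_conjAlgEquiv φ.symm e.symm (conjAlgEquiv_symm_ofMulAction φ e hinter) hT', ?_⟩
    apply LinearMap.ext
    intro x
    change (e.conjAlgEquiv k) ((e.symm.conjAlgEquiv k) T') x = T' x
    rw [LinearEquiv.conjAlgEquiv_apply, LinearEquiv.conjAlgEquiv_apply]
    simp only [LinearMap.comp_apply, LinearEquiv.coe_coe, LinearEquiv.symm_symm,
      LinearEquiv.apply_symm_apply]

end Generic

section Quotient

variable (k : Type*) [Field k] {G G' : Type*} [Group G] [Group G'] (φ : G ≃* G') {K : Subgroup G}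
  {K' : Subgroup G'} (hK : ∀ g, g ∈ K ↔ φ g ∈ K')

/-- **`G/K ≃ G'/K'`** induced by `φ` with `φ(K) = K'`: `gK ↦ φ(g)K'`. -/
def quotientEquivOfMulEquiv : G ⧸ K ≃ G' ⧸ K' :=
  Quotient.congr φ.toEquiv fun a b => by
    rw [QuotientGroup.leftRel_apply, QuotientGroup.leftRel_apply, hK, map_mul, map_inv]
    rfl

/-- `quotientEquivOfMulEquiv` on classes. -/
theorem quotientEquivOfMulEquiv_mk (g : G) :
    quotientEquivOfMulEquiv φ hK (g : G ⧸ K) = (φ g : G' ⧸ K') :=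
  Quotient.congr_mk _ _ g

/-- **Equivariance**: `e(g • x) = φ(g) • e(x)`. -/
theorem quotientEquivOfMulEquiv_smul (g : G) (x : G ⧸ K) :
    quotientEquivOfMulEquiv φ hK (g • x) = φ g • quotientEquivOfMulEquiv φ hK x := by
  induction x using QuotientGroup.induction_on with
  | H a =>
    rw [MulAction.Quotient.smul_mk, quotientEquivOfMulEquiv_mk, quotientEquivOfMulEquiv_mk,
      MulAction.Quotient.smul_mk, smul_eq_mul, smul_eq_mul, map_mul]

/-- The induced `k[G/K] ≃ₗ[k] k[G'/K']` (`MonoidAlgebra.mapDomainLinearEquiv`). -/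
noncomputable def permEquivOfMulEquiv :
    MonoidAlgebra k (G ⧸ K) ≃ₗ[k] MonoidAlgebra k (G' ⧸ K') :=
  MonoidAlgebra.mapDomainLinearEquiv k k (quotientEquivOfMulEquiv φ hK)

/-- **The intertwining**: `e ∘ ρ(g) ∘ e⁻¹ = ρ'(φ g)` on the permutation modules. -/
theorem conjAlgEquiv_ofMulAction (g : G) :
    (permEquivOfMulEquiv k φ hK).conjAlgEquiv k (Representation.ofMulAction k G (G ⧸ K) g) =
      Representation.ofMulAction k G' (G' ⧸ K') (φ g) := by
  rw [LinearEquiv.conjAlgEquiv_apply]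
  apply MonoidAlgebra.lhom_ext'
  intro x
  apply LinearMap.ext
  intro c
  simp only [LinearMap.comp_apply, MonoidAlgebra.lsingle_apply, LinearEquiv.coe_coe,
    permEquivOfMulEquiv, MonoidAlgebra.symm_mapDomainLinearEquiv,
    MonoidAlgebra.mapDomainLinearEquiv_single, Representation.ofMulAction_single,
    quotientEquivOfMulEquiv_smul, Equiv.apply_symm_apply]

/-- **`H(G, K) ≃ₐ[k] H(G', K')`** for `φ : G ≃* G'` with `φ(K) = K'`. -/
noncomputable def heckeAlgebraEquivOfMulEquiv : heckeAlgebra k K ≃ₐ[k] heckeAlgebra k K' :=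
  (AlgEquiv.subalgebraMap ((permEquivOfMulEquiv k φ hK).conjAlgEquiv k) (heckeAlgebra k K)).trans
    (Subalgebra.equivOfEq _ _
      (centralizer_map_conjAlgEquiv φ (permEquivOfMulEquiv k φ hK) (conjAlgEquiv_ofMulAction k φ hK)))

include φ hK in
/-- **Commutativity of `H(G, K)` is transported to `H(G', K')`.** -/
theorem heckeAlgebra_mul_comm_of_mulEquiv (hcomm : ∀ T S : heckeAlgebra k K, T * S = S * T) :
    ∀ T S : heckeAlgebra k K', T * S = S * T := by
  intro T S
  set ε := heckeAlgebraEquivOfMulEquiv k φ hK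
  calc T * S = ε (ε.symm T) * ε (ε.symm S) := by rw [ε.apply_symm_apply, ε.apply_symm_apply]
    _ = ε (ε.symm T * ε.symm S) := (map_mul ε _ _).symm
    _ = ε (ε.symm S * ε.symm T) := by rw [hcomm]
    _ = S * T := by rw [map_mul, ε.apply_symm_apply, ε.apply_symm_apply]

end Quotient

end Summit.Ventures.HodgeRepro2.T5HeckeIsomorphismTransport
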